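import Mathlib.Data.Finset.Sort
import Summits.MatrixMultiplication.OmegaCensus.IndepSetSearch
import Summits.MatrixMultiplication.OmegaCensus.BoxIndependence
import Literature.Computability.AlgebraicComplexity.TPPGroupExtension

/-!
# ω-census, family (b3): box bounds for `Q × A` from an enumerated small group `Q` — generic coding, normalisation and glue

HONEST FRAMING (pub-omega census; verbatim): lottery ticket; floor = certified bounds/negative ranges.
Census BOOKKEEPING machinery for the box bound of `ProductBoxBound.lean` (`box_bound`); no value of `ω` is touched here.
`S3BoxIndependence.lean` (`α_{S₃}(6,3,3) ≤ 10`) and the `Dic₃` files (`Dic3BoxDefs.lean` …, `α_{Dic₃}(12,3,3) ≤ 20`) each re-prove, for one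
concrete group, the same bookkeeping around a kernel computation.  This file proves it ONCE for any group `G` given with an enumeration
`E : GEnum G` by the naturals `< E.N` (identity ↦ `0`), so that an instance file for a further small group (`D₄`, `Q₈`, `D₅`, … — the
census's "next boxes") only supplies literal tables and their `decide` checks:
1. CODING (`cellOf`, `code`, `adjOK`, `boxOK_of_bound`, `boxOK_of_rangeBound`): cells `(x, y, w)` of a box `G × Y × W` (`Y`, `W` given as
   index lists `Yl`, `Wl` of length `3`) are coded by `9·ix x + 3·pos y + pos w < 9N`; `adjOK` checks an adjacency table against `cellWord` in
   the group (every flagged pair interacts); then ANY bound "every `adj`-independent set of naturals `< 9N` has `< k + 1` elements" — however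
   certified (`IndepSetSearch.noIndep`, `IndepSetCert.Cert.sound`, `IndepSetCertFast.NoIndep`) — gives `BoxIndep.BoxOK k univ Y W`;
   `boxOK_of_orbit` first spends the free right translations of the first coordinate (an independent set either avoids the cells over one
   position pair or, translated, contains the cell `(1, y₀, w₀)`; generic form of `Dic3BoxDefs.boxOK_of_orbit`).
2. NORMALISATION (`trip0`, `transformOK`, `coverAll`, `boxOK_three_of_coverAll`): by right translations both coordinate sets contain `1`,
   i.e. are listed by increasing index triples `[0, j, k]`; a literal table assigns to every pair of such triples a swap flag, two translating
   elements, a conjugating element and a representative `r ≤ R`; if the table checks (`coverAll … = true`, one `decide` in the instance file)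
   and the representatives satisfy `BoxOK k`, every box with `|Y| = |W| = 3` does (`BoxIndep.BoxOK.of_mulY/of_mulW/of_conj/of_swap`).
3. CONSEQUENCES (`boxOK_of_card_le_three`, `tpp_volume_le_of_boxOK`, `not_realizesTPP_prod_of_boxOK`(`_all_orders`)): the constant passes
   to `|Y|, |W| ≤ 3` and any `X`; `box_bound` turns it into `|S||T||U| ≤ k·|A|` for TPP triples of `G × A` (`A` finite abelian) with
   `|T|, |U| ≤ 3`, hence `G × A` realizes no `⟨N, 3, 3⟩` (in any order of the sizes) once `k·|A| < 9N`.
Elementary new mathematics of the cell (finite bookkeeping), not a published statement: it lives under `Summits/`, not `Literature/`.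
-/

open Finset Literature.Combinatorics.Additive
open Summit.MatrixMultiplication.OmegaCensus.ProductBoxBound Summit.MatrixMultiplication.OmegaCensus.IndepSearch
open Summit.MatrixMultiplication.OmegaCensus.BoxIndep

namespace Summit.MatrixMultiplication.OmegaCensus.BoxEnum

/-- An enumeration of a group by the naturals `< N`, identity first: `el` lists the elements (junk above `N`), `ix` is its inverse.
[folklore] -/
structure GEnum (G : Type*) [Group G] where
  /-- the number of elements -/
  N : ℕ
  /-- the element of index `i` (junk for `i ≥ N`) -/
  el : ℕ → G
  /-- the index of an element -/
  ix : G → ℕ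
  /-- indices are `< N` -/
  ix_lt : ∀ q, ix q < N
  /-- `el` inverts `ix` -/
  el_ix : ∀ q, el (ix q) = q
  /-- `ix` inverts `el` below `N` -/
  ix_el : ∀ i < N, ix (el i) = i
  /-- the identity has index `0` -/
  ix_one : ix 1 = 0

namespace GEnum

variable {G : Type*} [Group G] (E : GEnum G)

/-- `ix` is injective. [folklore] -/ theorem ix_injective : Function.Injective E.ix := fun a b h => by rw [← E.el_ix a, ← E.el_ix b, h]

/-! ## 1. Coding cells by naturals, sound adjacency tables, glue -/

/-- The cell coded by `c < 9N` in the box with coordinate index lists `Yl`, `Wl`: `(el (c / 9), el Yl[c / 3 % 3], el Wl[c % 3])`. [folklore] -/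
def cellOf (Yl Wl : List ℕ) (c : ℕ) : G × G × G := (E.el (c / 9), E.el (Yl.getD (c / 3 % 3) 0), E.el (Wl.getD (c % 3) 0))

/-- The code of a cell of the box `(Yl, Wl)`: `9·ix x + 3·pos y + pos w`. [folklore] -/
def code (Yl Wl : List ℕ) (P : G × G × G) : ℕ := 9 * E.ix P.1 + 3 * Yl.idxOf (E.ix P.2.1) + Wl.idxOf (E.ix P.2.2)

/-- Soundness check of an adjacency table against the group: every flagged pair `(c, c')` of codes `< 9N` is a pair of DISTINCT codes whose
cells interact (`cellWord = 1` in one of the two orders).  Only this direction is needed (missing flags only weaken a bound). [folklore] -/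
def adjOK [DecidableEq G] (Yl Wl : List ℕ) (adj : ℕ → ℕ) : Bool :=
  (List.range (9 * E.N)).all fun c => (List.range (9 * E.N)).all fun c' =>
    !(adj c).testBit c' || (!(c == c') &&
      (decide (cellWord (E.cellOf Yl Wl c) (E.cellOf Yl Wl c') = 1) || decide (cellWord (E.cellOf Yl Wl c') (E.cellOf Yl Wl c) = 1)))

/-- Reading `adjOK`. [folklore] -/
theorem interact_of_adjOK [DecidableEq G] {Yl Wl : List ℕ} {adj : ℕ → ℕ} (h : E.adjOK Yl Wl adj = true) {c c' : ℕ}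
    (hc : c < 9 * E.N) (hc' : c' < 9 * E.N) (ht : (adj c).testBit c' = true) :
    c ≠ c' ∧ (cellWord (E.cellOf Yl Wl c) (E.cellOf Yl Wl c') = 1 ∨ cellWord (E.cellOf Yl Wl c') (E.cellOf Yl Wl c) = 1) := by
  simp only [adjOK, List.all_eq_true, List.mem_range, Bool.or_eq_true, Bool.and_eq_true,
    decide_eq_true_eq, ne_eq, Bool.not_eq_eq_eq_not, Bool.not_true, beq_eq_false_iff_ne] at h
  rcases h c hc c' hc' with h | h
  exacts [by rw [ht] at h; exact absurd h (by decide), h]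

section Coding
variable {E} [Fintype G] [DecidableEq G]
variable {Yl Wl : List ℕ} (hYl : Yl.length = 3) (hWl : Wl.length = 3) (hY : ∀ a ∈ Yl, a < E.N) (hW : ∀ a ∈ Wl, a < E.N)
include hYl hWl hY hW

/-- Decoding: a cell of the box has code `< 9N`, `cellOf` recovers it, and the code's residue mod `9` is the position pair. [folklore] -/
theorem code_lt_and_cellOf_code {P : G × G × G} (hP : P ∈ (univ : Finset G) ×ˢ ((Yl.map E.el).toFinset ×ˢ (Wl.map E.el).toFinset)) :
    E.code Yl Wl P < 9 * E.N ∧ E.cellOf Yl Wl (E.code Yl Wl P) = P ∧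
      E.code Yl Wl P % 9 = 3 * Yl.idxOf (E.ix P.2.1) + Wl.idxOf (E.ix P.2.2) := by
  classical
  obtain ⟨x, y, w⟩ := P
  simp only [mem_product, mem_univ, true_and, List.mem_toFinset, List.mem_map] at hP
  obtain ⟨⟨a, ha, rfl⟩, ⟨b, hb, rfl⟩⟩ := hP
  have hy : E.ix (E.el a) ∈ Yl := by rwa [E.ix_el a (hY a ha)]
  have hw : E.ix (E.el b) ∈ Wl := by rwa [E.ix_el b (hW b hb)]
  have hj : Yl.idxOf (E.ix (E.el a)) < 3 := hYl ▸ List.idxOf_lt_length_of_mem hy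
  have hk : Wl.idxOf (E.ix (E.el b)) < 3 := hWl ▸ List.idxOf_lt_length_of_mem hw
  have hx := E.ix_lt x
  refine ⟨by simp only [code]; omega, ?_, by simp only [code]; omega⟩
  have e1 : (9 * E.ix x + 3 * Yl.idxOf (E.ix (E.el a)) + Wl.idxOf (E.ix (E.el b))) / 9 = E.ix x := by omega
  have e2 : (9 * E.ix x + 3 * Yl.idxOf (E.ix (E.el a)) + Wl.idxOf (E.ix (E.el b))) / 3 % 3 = Yl.idxOf (E.ix (E.el a)) := by omega
  have e3 : (9 * E.ix x + 3 * Yl.idxOf (E.ix (E.el a)) + Wl.idxOf (E.ix (E.el b))) % 3 = Wl.idxOf (E.ix (E.el b)) := by omega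
  have gY : Yl.getD (Yl.idxOf (E.ix (E.el a))) 0 = E.ix (E.el a) := by
    rw [List.getD_eq_getElem _ _ (List.idxOf_lt_length_of_mem hy), List.getElem_idxOf]
  have gW : Wl.getD (Wl.idxOf (E.ix (E.el b))) 0 = E.ix (E.el b) := by
    rw [List.getD_eq_getElem _ _ (List.idxOf_lt_length_of_mem hw), List.getElem_idxOf]
  simp only [cellOf, code, e1, e2, e3, gY, gW, E.el_ix]

/-- **Coding lemma.** An independent cell set inside the box is coded injectively into an `adj`-independent set of naturals `< 9N`
(for a sound table `adj`). [folklore] -/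
theorem image_code {adj : ℕ → ℕ} (hadj : E.adjOK Yl Wl adj = true) {I : Finset (G × G × G)}
    (hI : I ⊆ (univ : Finset G) ×ˢ ((Yl.map E.el).toFinset ×ˢ (Wl.map E.el).toFinset))
    (hind : ∀ P ∈ I, ∀ P' ∈ I, P ≠ P' → cellWord P P' ≠ 1) :
    Set.InjOn (E.code Yl Wl) I ∧ IndepN adj (I.image (E.code Yl Wl)) ∧ ∀ a ∈ I.image (E.code Yl Wl), a < 9 * E.N := by
  classical
  have hdec := fun P (hP : P ∈ I) => code_lt_and_cellOf_code hYl hWl hY hW (hI hP)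
  have hinj : Set.InjOn (E.code Yl Wl) I := fun P hP P' hP' e => by
    rw [← (hdec P hP).2.1, ← (hdec P' hP').2.1, e]
  refine ⟨hinj, fun a ha b hb hab => ?_, fun a ha => ?_⟩
  · obtain ⟨P, hP, rfl⟩ := mem_image.1 ha
    obtain ⟨P', hP', rfl⟩ := mem_image.1 hb
    cases ht : (adj (E.code Yl Wl P)).testBit (E.code Yl Wl P')
    · rfl
    · exfalso
      have hPP' : P ≠ P' := fun e => hab (by rw [e])
      obtain ⟨-, hw⟩ := E.interact_of_adjOK hadj (hdec P hP).1 (hdec P' hP').1 ht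
      rw [(hdec P hP).2.1, (hdec P' hP').2.1] at hw
      rcases hw with hw | hw
      · exact hind P hP P' hP' hPP' hw
      · exact hind P' hP' P hP hPP'.symm hw
  · obtain ⟨P, hP, rfl⟩ := mem_image.1 ha
    exact (hdec P hP).1

/-- **Glue.** A sound table and ANY certified bound "every `adj`-independent set of naturals `< 9N` has fewer than `k + 1` elements" give
`BoxOK k` for the box `G × Y × W`. [folklore] -/
theorem boxOK_of_bound {adj : ℕ → ℕ} (hadj : E.adjOK Yl Wl adj = true) (k : ℕ)
    (h : ∀ I : Finset ℕ, IndepN adj I → (∀ a ∈ I, a < 9 * E.N) → I.card < k + 1) :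
    BoxOK k (univ : Finset G) (Yl.map E.el).toFinset (Wl.map E.el).toFinset := by
  classical
  intro I hI hind
  obtain ⟨hinj, hJ, hlt⟩ := image_code hYl hWl hY hW hadj hI hind
  have := h _ hJ hlt; rw [card_image_of_injOn hinj] at this; omega

/-- **Glue, checker form.** The same with the bound in the shape produced by the kernel checkers on the whole vertex range
(`IndepSetCert.Cert.sound` / `card_lt_of_mcq` with `vs = List.range (9N)` and the full mask `2 ^ (9N) - 1`). [folklore] -/
theorem boxOK_of_rangeBound {adj : ℕ → ℕ} (hadj : E.adjOK Yl Wl adj = true) (k : ℕ)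
    (h : ∀ I : Finset ℕ, IndepN adj I → (∀ a ∈ I, a ∈ List.range (9 * E.N) ∧ (2 ^ (9 * E.N) - 1).testBit a = true) → I.card < k + 1) :
    BoxOK k (univ : Finset G) (Yl.map E.el).toFinset (Wl.map E.el).toFinset :=
  boxOK_of_bound hYl hWl hY hW hadj k fun I hI hlt => h I hI fun a ha =>
    ⟨List.mem_range.2 (hlt a ha), by rw [Nat.testBit_two_pow_sub_one]; simpa using hlt a ha⟩

/-- **Orbit glue** (free right translations of the first coordinate).  For a sound table, a position pair `j₀ < 9`, a bound `k + 1` on the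
independent sets of codes AVOIDING the residue `j₀` (`hA`) and a bound `k` on the independent sets of codes among the non-neighbours of the code
`j₀` (= the cell `(1, y₀, w₀)`; `hB`), the box satisfies `BoxOK k`: an independent cell set meeting the fibre of `j₀` is translated (first
coordinate, on the right — `cellWord` is invariant) so as to contain `(1, y₀, w₀)`, and the rest of it then lies among that cell's
non-neighbours.  (Generic form of `Dic3BoxDefs.boxOK_of_orbit`.) [folklore] -/
theorem boxOK_of_orbit {adj : ℕ → ℕ} (hadj : E.adjOK Yl Wl adj = true) (k j₀ : ℕ)
    (hA : ∀ I : Finset ℕ, IndepN adj I → (∀ a ∈ I, a < 9 * E.N ∧ a % 9 ≠ j₀) → I.card < k + 1)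
    (hB : ∀ I : Finset ℕ, IndepN adj I → (∀ a ∈ I, a < 9 * E.N ∧ a ≠ j₀ ∧ (adj j₀).testBit a = false) → I.card < k) :
    BoxOK k (univ : Finset G) (Yl.map E.el).toFinset (Wl.map E.el).toFinset := by
  classical
  intro I hI hind
  by_cases hmeet : ∃ P ∈ I, E.code Yl Wl P % 9 = j₀
  · -- translate so that the cell over `j₀` becomes `(1, y₀, w₀)`
    obtain ⟨P₀, hP₀, hP₀j⟩ := hmeet
    let g : G := P₀.1
    let φ : G × G × G → G × G × G := fun P => (P.1 * g⁻¹, P.2)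
    have hφinj : Function.Injective φ := by
      rintro ⟨x, y, w⟩ ⟨x', y', w'⟩ e
      simp only [φ, Prod.mk.injEq, mul_left_inj] at e
      obtain ⟨rfl, rfl, rfl⟩ := e; rfl
    have hword : ∀ P P' : G × G × G, cellWord (φ P) (φ P') = cellWord P P' := by
      rintro ⟨x, y, w⟩ ⟨x', y', w'⟩
      simp only [φ, cellWord, mul_inv_rev, inv_inv]
      group
    set I' := I.image φ with hI'def
    have hI' : I' ⊆ (univ : Finset G) ×ˢ ((Yl.map E.el).toFinset ×ˢ (Wl.map E.el).toFinset) := by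
      intro R hR
      obtain ⟨P, hP, rfl⟩ := mem_image.1 hR
      have := hI hP
      simp only [mem_product, mem_univ, true_and] at this ⊢
      exact this
    have hind' : ∀ R ∈ I', ∀ R' ∈ I', R ≠ R' → cellWord R R' ≠ 1 := by
      intro R hR R' hR' hne
      obtain ⟨P, hP, rfl⟩ := mem_image.1 hR
      obtain ⟨P', hP', rfl⟩ := mem_image.1 hR'
      rw [hword]
      exact hind P hP P' hP' fun e => hne (by rw [e])
    have hcard : I'.card = I.card := card_image_of_injective I hφinj
    set P₁ : G × G × G := φ P₀ with hP₁def
    have hP₁I' : P₁ ∈ I' := mem_image_of_mem φ hP₀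
    have hdec := fun P (hP : P ∈ I') => code_lt_and_cellOf_code hYl hWl hY hW (hI' hP)
    have hcode₁ : E.code Yl Wl P₁ = j₀ := by
      have h1 : P₁.1 = 1 := by simp [hP₁def, φ, g]
      have hc : E.code Yl Wl P₁ = 3 * Yl.idxOf (E.ix P₀.2.1) + Wl.idxOf (E.ix P₀.2.2) := by
        show 9 * E.ix P₁.1 + 3 * Yl.idxOf (E.ix P₁.2.1) + Wl.idxOf (E.ix P₁.2.2) = _
        rw [h1, E.ix_one]
        simp [hP₁def, φ]
      have hc0 := (code_lt_and_cellOf_code hYl hWl hY hW (hI hP₀)).2.2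
      rw [hc, ← hc0, hP₀j]
    obtain ⟨hinj, hJ, hlt⟩ := image_code hYl hWl hY hW hadj hI' hind'
    have hJ' : IndepN adj ((I'.erase P₁).image (E.code Yl Wl)) := fun a ha b hb hab =>
      hJ a (image_subset_image (erase_subset _ _) ha) b (image_subset_image (erase_subset _ _) hb) hab
    have hsub : ∀ a ∈ (I'.erase P₁).image (E.code Yl Wl), a < 9 * E.N ∧ a ≠ j₀ ∧ (adj j₀).testBit a = false := by
      intro a ha
      obtain ⟨P, hP, rfl⟩ := mem_image.1 ha
      have hPne : P ≠ P₁ := ne_of_mem_erase hP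
      have hPI' := mem_of_mem_erase hP
      have hne : E.code Yl Wl P ≠ j₀ := fun e => hPne (hinj hPI' hP₁I' (e.trans hcode₁.symm))
      refine ⟨(hdec P hPI').1, hne, ?_⟩
      rw [← hcode₁]
      exact hJ _ (mem_image_of_mem _ hP₁I') _ (mem_image_of_mem _ hPI') (hcode₁ ▸ hne.symm)
    have hk := hB _ hJ' hsub
    rw [card_image_of_injOn (fun P hP P' hP' e => hinj (mem_of_mem_erase hP) (mem_of_mem_erase hP') e),
      card_erase_of_mem hP₁I'] at hk
    omega
  · -- `I` avoids the fibre of `j₀`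
    obtain ⟨hinj, hJ, hlt⟩ := image_code hYl hWl hY hW hadj hI hind
    have hdec := fun P (hP : P ∈ I) => code_lt_and_cellOf_code hYl hWl hY hW (hI hP)
    have hsub : ∀ a ∈ I.image (E.code Yl Wl), a < 9 * E.N ∧ a % 9 ≠ j₀ := by
      intro a ha
      obtain ⟨P, hP, rfl⟩ := mem_image.1 ha
      exact ⟨(hdec P hP).1, fun e => hmeet ⟨P, hP, e⟩⟩
    have := hA _ hJ hsub; rw [card_image_of_injOn hinj] at this; omega
end Coding

/-! ## 2. Normalisation: every pair of `3`-subsets is carried to a representative -/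

/-- The increasing index triples `[0, j, k]`, `0 < j < k < N` (the `3`-subsets containing `1`; rank = position). [folklore] -/
def trip0 : List (List ℕ) :=
  (List.range E.N).flatMap fun j => (List.range E.N).flatMap fun k => if 0 < j ∧ j < k then [[0, j, k]] else []

/-- Same members (Boolean test on lists of naturals). [folklore] -/ def sameSet (l l' : List ℕ) : Bool := l.all (fun a => l'.elem a) && l'.all (fun a => l.elem a)

/-- The normalising transformation packed in `p = s + 2(g₁ + N(g₂ + N(h + N·r)))` moves `(L, L')` onto representative `r` (capped at `R`):
optionally swap, right-translate the coordinates by `el g₁`, `el g₂`, conjugate by `el h`, compare member sets with `(YL r, WL r)`. [folklore] -/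
def transformOK (YL WL : ℕ → List ℕ) (R : ℕ) (L L' : List ℕ) (p : ℕ) : Bool :=
  let s := p % 2
  let g₁ := p / 2 % E.N
  let g₂ := p / (2 * E.N) % E.N
  let h := p / (2 * E.N * E.N) % E.N
  let r := min (p / (2 * E.N * E.N * E.N)) R
  let A := if s = 1 then L' else L
  let B := if s = 1 then L else L'
  sameSet (A.map fun a => E.ix (E.el h * (E.el a * E.el g₁) * (E.el h)⁻¹)) (YL r) &&
    sameSet (B.map fun b => E.ix (E.el h * (E.el b * E.el g₂) * (E.el h)⁻¹)) (WL r)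

/-- Every pair of normalised triples is carried to a representative by its table entry `covFn (rank L) (rank L')`. [folklore] -/
def coverAll (YL WL : ℕ → List ℕ) (R : ℕ) (covFn : ℕ → ℕ → ℕ) : Bool :=
  E.trip0.all fun L => E.trip0.all fun L' => E.transformOK YL WL R L L' (covFn (E.trip0.idxOf L) (E.trip0.idxOf L'))

/-- Increasing triples `[0, j, k]` below `N` are listed in `trip0`. [folklore] -/
theorem mem_trip0 {j k : ℕ} (hk : k < E.N) (hjk : j < k) (hj : 0 < j) : [0, j, k] ∈ E.trip0 := by
  simp only [trip0, List.mem_flatMap, List.mem_range]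
  exact ⟨j, by omega, k, hk, by simp [hj, hjk]⟩

/-- `sameSet` means equal member sets. [folklore] -/ theorem mem_iff_of_sameSet {l l' : List ℕ} (h : sameSet l l' = true) (a : ℕ) : a ∈ l ↔ a ∈ l' := by
  simp only [sameSet, Bool.and_eq_true, List.all_eq_true, List.elem_iff] at h
  exact ⟨h.1 a, h.2 a⟩

/-- Lists with the same members list the same finset. [folklore] -/
theorem toFinset_eq_of_sameSet [DecidableEq G] {l l' : List ℕ} (h : sameSet l l' = true) :
    (l.map E.el).toFinset = (l'.map E.el).toFinset := by
  ext q
  simp only [List.mem_toFinset, List.mem_map]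
  constructor
  · rintro ⟨a, ha, rfl⟩; exact ⟨a, (mem_iff_of_sameSet h a).1 ha, rfl⟩
  · rintro ⟨a, ha, rfl⟩; exact ⟨a, (mem_iff_of_sameSet h a).2 ha, rfl⟩

/-- Translating then conjugating the listed finset of `L` gives the listed finset of the transformed index list. [folklore] -/
theorem transform_toFinset [DecidableEq G] (L : List ℕ) (g c : G) :
    (((L.map E.el).toFinset.image (· * g)).image fun y => c * y * c⁻¹) =
      ((L.map fun a => E.ix (c * (E.el a * g) * c⁻¹)).map E.el).toFinset := by
  ext q
  simp only [mem_image, List.mem_toFinset, List.mem_map]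
  constructor
  · rintro ⟨y, ⟨x, ⟨a, ha, rfl⟩, rfl⟩, rfl⟩
    exact ⟨E.ix (c * (E.el a * g) * c⁻¹), ⟨a, ha, rfl⟩, E.el_ix _⟩
  · rintro ⟨b, ⟨a, ha, rfl⟩, rfl⟩
    exact ⟨E.el a * g, ⟨E.el a, ⟨a, ha, rfl⟩, rfl⟩, (E.el_ix _).symm⟩

/-- A `3`-subset of `G` containing `1` is the listed finset of a triple in `trip0`. [folklore] -/
theorem exists_trip0_of_card_three [DecidableEq G] (Y : Finset G) (h1 : (1 : G) ∈ Y) (hY : Y.card = 3) :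
    ∃ L ∈ E.trip0, (L.map E.el).toFinset = Y := by
  classical
  set L := (Y.image E.ix).sort with hL
  have hlen : L.length = 3 := by
    rw [hL, length_sort, card_image_of_injective _ E.ix_injective, hY]
  have hnd : L.Nodup := sort_nodup _ _
  have hpw : L.Pairwise (· ≤ ·) := pairwise_sort _ _
  have hmem : ∀ a, a ∈ L ↔ a ∈ Y.image E.ix := fun a => by rw [hL, mem_sort]
  have hY' : (L.map E.el).toFinset = Y := by
    ext q
    simp only [List.mem_toFinset, List.mem_map, hmem, mem_image]
    constructor
    · rintro ⟨a, ⟨y, hy, rfl⟩, rfl⟩; rwa [E.el_ix]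
    · intro hq; exact ⟨E.ix q, ⟨q, hq, rfl⟩, E.el_ix q⟩
  have h0 : 0 ∈ L := (hmem 0).2 (mem_image.2 ⟨1, h1, E.ix_one⟩)
  refine ⟨L, ?_, hY'⟩
  match e : L, hlen with
  | [i, j, k], _ =>
    have hkN : k < E.N := by
      obtain ⟨y, -, hy⟩ := mem_image.1 ((hmem k).1 (by simp))
      rw [← hy]; exact E.ix_lt y
    simp only [List.pairwise_cons, List.mem_cons, List.nodup_cons, forall_eq_or_imp, forall_eq,
      List.not_mem_nil, or_false, not_or] at hpw hnd h0
    have hi : i = 0 := by rcases h0 with h0 | h0 | h0 <;> omega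
    subst hi
    exact E.mem_trip0 hkN (lt_of_le_of_ne hpw.2.1 hnd.2.1) (Nat.pos_of_ne_zero (Ne.symm hnd.1.1))

/-- **Normalisation theorem, `1 ∈ Y, W` form.** If the covering table checks and the representatives `r ≤ R` satisfy `BoxOK k`, every box
`G × Y × W` with `1 ∈ Y`, `1 ∈ W`, `|Y| = |W| = 3` satisfies `BoxOK k`. [folklore] -/
theorem boxOK_three_one_of_coverAll [Fintype G] [DecidableEq G] {k R : ℕ} {YL WL : ℕ → List ℕ} {covFn : ℕ → ℕ → ℕ}
    (hcov : E.coverAll YL WL R covFn = true) (hreps : ∀ r ≤ R, BoxOK k (univ : Finset G) ((YL r).map E.el).toFinset ((WL r).map E.el).toFinset)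
    (Y W : Finset G) (h1Y : (1 : G) ∈ Y) (h1W : (1 : G) ∈ W) (hY : Y.card = 3) (hW : W.card = 3) : BoxOK k univ Y W := by
  classical
  obtain ⟨L, hL, rfl⟩ := E.exists_trip0_of_card_three Y h1Y hY
  obtain ⟨L', hL', rfl⟩ := E.exists_trip0_of_card_three W h1W hW
  have hc := hcov
  simp only [coverAll, List.all_eq_true] at hc
  have ht := hc L hL L' hL'
  generalize covFn (E.trip0.idxOf L) (E.trip0.idxOf L') = p at ht
  simp only [transformOK, Bool.and_eq_true] at ht
  obtain ⟨hA, hB⟩ := ht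
  set g₁ := E.el (p / 2 % E.N)
  set g₂ := E.el (p / (2 * E.N) % E.N)
  set c := E.el (p / (2 * E.N * E.N) % E.N)
  set r := min (p / (2 * E.N * E.N * E.N)) R
  have hrep := hreps r (Nat.min_le_right _ _)
  rw [← E.toFinset_eq_of_sameSet hA, ← E.toFinset_eq_of_sameSet hB, ← E.transform_toFinset, ← E.transform_toFinset] at hrep
  by_cases hs : p % 2 = 1
  · simp only [hs, if_true] at hrep
    exact BoxOK.of_swap (BoxOK.of_mulY g₁ (BoxOK.of_mulW g₂ (BoxOK.of_conj c hrep)))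
  · simp only [hs, if_false] at hrep
    exact BoxOK.of_mulY g₁ (BoxOK.of_mulW g₂ (BoxOK.of_conj c hrep))

/-- **Normalisation theorem.** If the covering table checks and the representatives satisfy `BoxOK k`, every box `G × Y × W` with
`|Y| = |W| = 3` satisfies `BoxOK k` (translate `Y`, `W` so as to contain `1`). [folklore] -/
theorem boxOK_three_of_coverAll [Fintype G] [DecidableEq G] {k R : ℕ} {YL WL : ℕ → List ℕ} {covFn : ℕ → ℕ → ℕ}
    (hcov : E.coverAll YL WL R covFn = true) (hreps : ∀ r ≤ R, BoxOK k (univ : Finset G) ((YL r).map E.el).toFinset ((WL r).map E.el).toFinset)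
    (Y W : Finset G) (hY : Y.card = 3) (hW : W.card = 3) : BoxOK k univ Y W := by
  classical
  obtain ⟨y, hy⟩ : Y.Nonempty := card_pos.1 (by omega)
  obtain ⟨w, hw⟩ : W.Nonempty := card_pos.1 (by omega)
  refine BoxOK.of_mulY y⁻¹ (BoxOK.of_mulW w⁻¹ (E.boxOK_three_one_of_coverAll hcov hreps _ _ ?_ ?_ ?_ ?_))
  · exact mem_image.2 ⟨y, hy, mul_inv_cancel y⟩
  · exact mem_image.2 ⟨w, hw, mul_inv_cancel w⟩
  · rw [card_image_of_injective _ (mul_left_injective _), hY]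
  · rw [card_image_of_injective _ (mul_left_injective _), hW]

end GEnum

/-! ## 3. Consequences of a box constant (no enumeration needed) -/

section Consequences
variable {G : Type*} [Group G]

/-- From `|Y| = |W| = 3` and `X = univ` to `|Y|, |W| ≤ 3` and any `X` (groups with at least three elements). [folklore] -/
theorem boxOK_of_card_le_three [Fintype G] [DecidableEq G] {k : ℕ} (h3 : 3 ≤ Fintype.card G)
    (hthree : ∀ Y W : Finset G, Y.card = 3 → W.card = 3 → BoxOK k univ Y W)
    (X Y W : Finset G) (hY : Y.card ≤ 3) (hW : W.card ≤ 3) : BoxOK k X Y W := by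
  classical
  have h3' : 3 ≤ (univ : Finset G).card := by rwa [card_univ]
  obtain ⟨Y', hYY', -, hY'⟩ := exists_subsuperset_card_eq (subset_univ Y) hY h3'
  obtain ⟨W', hWW', -, hW'⟩ := exists_subsuperset_card_eq (subset_univ W) hW h3'
  exact (hthree Y' W' hY' hW').mono (subset_univ X) hYY' hWW'

/-- **Box bound for `G × A`** from a box constant `k`: for every finite abelian `A` and every TPP triple `(S, T, U)` of `G × A` with
`|T| ≤ 3` and `|U| ≤ 3`, `|S| |T| |U| ≤ k · |A|` (`ProductBoxBound.box_bound`). [folklore] -/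
theorem tpp_volume_le_of_boxOK [DecidableEq G] {k : ℕ} (hbox : ∀ X Y W : Finset G, Y.card ≤ 3 → W.card ≤ 3 → BoxOK k X Y W)
    {A : Type*} [CommGroup A] [Fintype A] [DecidableEq A] (S T U : Finset (G × A)) (h : TripleProductProperty S T U)
    (hT : T.card ≤ 3) (hU : U.card ≤ 3) : S.card * T.card * U.card ≤ k * Fintype.card A :=
  box_bound S T U h k fun I hI hind =>
    hbox _ _ _ (card_image_le.trans hT) (card_image_le.trans hU) I hI hind

/-- **No `⟨N, 3, 3⟩` in `G × A` when `k|A| < 9N`.** [folklore] -/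
theorem not_realizesTPP_prod_of_boxOK [DecidableEq G] {k : ℕ} (hbox : ∀ X Y W : Finset G, Y.card ≤ 3 → W.card ≤ 3 → BoxOK k X Y W)
    {A : Type*} [CommGroup A] [Fintype A] [DecidableEq A] (N : ℕ) (hlt : k * Fintype.card A < 9 * N) :
    ¬ Literature.Computability.AlgebraicComplexity.RealizesTPP (G × A) N 3 3 := by
  rintro ⟨S, T, U, hS, hT, hU, h⟩
  have := tpp_volume_le_of_boxOK hbox S T U h (by omega) (by omega); rw [hS, hT, hU] at this; omega

/-- The exclusion in every ordering of the size triple (cyclic shift of a TPP triple, `RealizesTPP.rotate`, Cohn–Umans 2003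
Lemma 2.1). [folklore] -/
theorem not_realizesTPP_prod_of_boxOK_all_orders [DecidableEq G] {k : ℕ}
    (hbox : ∀ X Y W : Finset G, Y.card ≤ 3 → W.card ≤ 3 → BoxOK k X Y W)
    {A : Type*} [CommGroup A] [Fintype A] [DecidableEq A] (N : ℕ) (hlt : k * Fintype.card A < 9 * N) :
    ¬ Literature.Computability.AlgebraicComplexity.RealizesTPP (G × A) N 3 3 ∧
      ¬ Literature.Computability.AlgebraicComplexity.RealizesTPP (G × A) 3 N 3 ∧
        ¬ Literature.Computability.AlgebraicComplexity.RealizesTPP (G × A) 3 3 N :=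
  ⟨not_realizesTPP_prod_of_boxOK hbox N hlt, fun h => not_realizesTPP_prod_of_boxOK hbox N hlt h.rotate,
    fun h => not_realizesTPP_prod_of_boxOK hbox N hlt h.rotate.rotate⟩

end Consequences
end Summit.MatrixMultiplication.OmegaCensus.BoxEnum
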